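import Mathlib
import Summits.Ventures.HSemireg.ApolarGramParity

/-!
# Venture HSemireg — apolar Gram matrix: RANK FORMS and the exponential-Hankel dictionary

HONEST FRAMING. Finite-dimensional real linear algebra only; no variety / sheaf / semiregularity map;
nothing here says that HC / HC_CM / HC_AV holds; no Literature fact is declared or assumed.

Continuation of `ApolarGramParity.lean` (cell pub-hsemireg, FORMULA-N PART A §2.9 THEOREM A;
th-7's one-sided rank law PART B §L.11–12; p6's kernel theorem `weilPurity_oneSided_b_zero` reduces
that law to the number `rank(H_n(q) Ω_n H_n(q))`). This file supplies

* the RANK FORMS of the parity cells: `rank_gram_eq` (`ρ ≢ n (mod 2)`, `2 ≤ ρ ≤ n+1` ⇒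
  `rank ((x_i − x_j)^n) = ρ`) and `rank_gram_eq_of_odd` (`n` odd, `ρ + 1` odd, `3 ≤ ρ+1 ≤ n+1` ⇒
  `rank = ρ`, i.e. corank one) — so for `n` odd `rank = 2⌊ρ/2⌋` in every case `ρ ≤ n + 1`;
* the DICTIONARY for exponential Hankel data `q_k = Σ_i c_i x_i^k` (`c_i ≠ 0`, distinct `x_i`,
  `ρ ≤ n + 1`): with `hsq n q = (q_{i+j})_{i,j ≤ n}` and `omega n = ((−1)^{n−m} C(n,m) δ_{l+m,n})`
  (the bodies of p6's `Wedge.Weil.Hsq` / `Wedge.Weil.Omega` at `K = ℝ`):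
  `hsq n q = Bᵀ V` (`B_{il} = c_i x_i^l`, `V_{il} = x_i^l`), `V Ω Vᵀ = ((x_j − x_i)^n) = (gram n x)ᵀ`
  (binomial theorem), and **`rank (hsq n q ⬝ omega n ⬝ hsq n q) = rank (gram n x)`**
  (`Bᵀ` injective and `B` onto, by a Vandermonde minor).
-/

noncomputable section

open Polynomial Finset Matrix
open scoped BigOperators

namespace Summit.Ventures.HSemireg.ApolarGram

/-! ### Rank forms of the parity cells -/

/-- `Matrix.rank` is the dimension of the range of `mulVecLin` (definition). -/
theorem rank_eq_finrank_range {m k : ℕ} (A : Matrix (Fin m) (Fin k) ℝ) :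
    A.rank = Module.finrank ℝ (LinearMap.range A.mulVecLin) := rfl

/-- **Parity cells, rank form**: `2 ≤ ρ ≤ n + 1`, `ρ ≢ n (mod 2)` ⇒ `rank ((x_i − x_j)^n) = ρ`. -/
theorem rank_gram_eq {n ρ : ℕ} (hρ : 2 ≤ ρ) (hρn : ρ ≤ n + 1) (hpar : ρ % 2 ≠ n % 2)
    {x : Fin ρ → ℝ} (hx : StrictMono x) : (gram n x).rank = ρ := by
  have hinj : Function.Injective (gram n x).mulVecLin := by
    rw [← LinearMap.ker_eq_bot, LinearMap.ker_eq_bot']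
    intro c hc
    exact gram_mulVec_eq_zero hρ hρn hpar hx hc
  rw [rank_eq_finrank_range, LinearMap.finrank_range_of_inj hinj, Module.finrank_fin_fun]

/-- **Cell (n odd, ρ odd), rank form**: `n` odd, `ρ + 1` odd, `3 ≤ ρ + 1 ≤ n + 1` ⇒ the
`(ρ+1) × (ρ+1)` matrix `((x_i − x_j)^n)` has rank exactly `ρ`. -/
theorem rank_gram_eq_of_odd {n ρ : ℕ} (hn : Odd n) (hρodd : Odd (ρ + 1)) (hρ : 3 ≤ ρ + 1)
    (hρn : ρ + 1 ≤ n + 1) {x : Fin (ρ + 1) → ℝ} (hx : StrictMono x) : (gram n x).rank = ρ := by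
  classical
  obtain ⟨⟨c₀, hc₀, hGc₀⟩, hprop⟩ := gram_ker_line_of_odd hn hρodd hρ hρn hx
  have hpar : ρ % 2 ≠ n % 2 := by
    rcases hn with ⟨a, ha⟩; rcases hρodd with ⟨b, hb⟩; omega
  -- the last coordinate of a non-zero kernel vector is non-zero
  have hlast : c₀ (Fin.last ρ) ≠ 0 := fun h =>
    hc₀ (gram_mulVec_eq_zero_of_last hρ hρn hpar hx hGc₀ h)
  -- the kernel is the line through c₀
  have hker1 : Module.finrank ℝ (LinearMap.ker (gram n x).mulVecLin) = 1 := by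
    apply le_antisymm
    · rw [finrank_le_one_iff]
      refine ⟨⟨c₀, hGc₀⟩, fun w => ?_⟩
      obtain ⟨w, hw⟩ := w
      have hw' : (gram n x).mulVec w = 0 := hw
      refine ⟨w (Fin.last ρ) / c₀ (Fin.last ρ), Subtype.ext ?_⟩
      have h := hprop w c₀ hw' hGc₀
      -- h : w_last • c₀ = c₀_last • w
      change (w (Fin.last ρ) / c₀ (Fin.last ρ)) • c₀ = w
      rw [div_eq_mul_inv, mul_comm, mul_smul, h, smul_smul, inv_mul_cancel₀ hlast, one_smul]
    · rw [Nat.one_le_iff_ne_zero, Ne, Submodule.finrank_eq_zero]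
      intro hbot
      have : c₀ ∈ LinearMap.ker (gram n x).mulVecLin := hGc₀
      rw [hbot, Submodule.mem_bot] at this
      exact hc₀ this
  have hrn := LinearMap.finrank_range_add_finrank_ker (gram n x).mulVecLin
  rw [hker1, Module.finrank_fin_fun] at hrn
  rw [rank_eq_finrank_range]
  omega

/-! ### The exponential-Hankel dictionary -/

section Dictionary

variable (n : ℕ) {ρ : ℕ}

/-- the square Hankel matrix `H_n(q) = (q_{i+j})_{0 ≤ i,j ≤ n}` (body of p6's `Wedge.Weil.Hsq`). -/
def hsq (q : ℕ → ℝ) : Matrix (Fin (n + 1)) (Fin (n + 1)) ℝ :=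
  Matrix.of fun i j => q ((i : ℕ) + (j : ℕ))

/-- th-7's pairing matrix `Ω_n = ((−1)^{n−m} C(n,m) δ_{l+m,n})` (body of p6's `Wedge.Weil.Omega`). -/
def omega : Matrix (Fin (n + 1)) (Fin (n + 1)) ℝ :=
  Matrix.of fun l m => if (l : ℕ) + (m : ℕ) = n then ((-1 : ℝ) ^ (n - (m : ℕ))) * (n.choose (m : ℕ) : ℝ) else 0

/-- exponential moment data `q_k = Σ_i c_i x_i^k`. -/
def expMoments (c x : Fin ρ → ℝ) : ℕ → ℝ := fun k => ∑ i, c i * x i ^ k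

/-- the node matrix `V_{il} = x_i^l` (`ρ × (n+1)`). -/
def nodeMat (x : Fin ρ → ℝ) : Matrix (Fin ρ) (Fin (n + 1)) ℝ := Matrix.of fun i l => x i ^ (l : ℕ)

/-- the weighted node matrix `B_{il} = c_i x_i^l`. -/
def wNodeMat (c x : Fin ρ → ℝ) : Matrix (Fin ρ) (Fin (n + 1)) ℝ :=
  Matrix.of fun i l => c i * x i ^ (l : ℕ)

/-- `H_n(q) = Bᵀ V` for exponential data. -/
theorem hsq_expMoments_eq (c x : Fin ρ → ℝ) :
    hsq n (expMoments c x) = (wNodeMat n c x)ᵀ * nodeMat n x := by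
  ext l m
  simp only [hsq, expMoments, wNodeMat, nodeMat, Matrix.mul_apply, Matrix.transpose_apply,
    Matrix.of_apply, pow_add, mul_assoc]

/-- `H_n(q) = Vᵀ B` as well (it is symmetric). -/
theorem hsq_expMoments_eq' (c x : Fin ρ → ℝ) :
    hsq n (expMoments c x) = (nodeMat n x)ᵀ * wNodeMat n c x := by
  ext l m
  simp only [hsq, expMoments, wNodeMat, nodeMat, Matrix.mul_apply, Matrix.transpose_apply,
    Matrix.of_apply, pow_add]
  exact Finset.sum_congr rfl fun i _ => by ring

/-- the binomial theorem in matrix form: `V Ω_n Vᵀ = ((x_j − x_i)^n)_{i,j} = (gram n x)ᵀ`. -/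
theorem nodeMat_omega_nodeMat_transpose (x : Fin ρ → ℝ) :
    nodeMat n x * omega n * (nodeMat n x)ᵀ = (gram n x)ᵀ := by
  ext i j
  simp only [Matrix.mul_apply, Matrix.transpose_apply, nodeMat, omega, gram, Matrix.of_apply]
  -- collapse the inner sum: only l = n − m contributes
  have hinner : ∀ m : Fin (n + 1),
      (∑ l : Fin (n + 1), x i ^ (l : ℕ) *
        (if (l : ℕ) + (m : ℕ) = n then (-1 : ℝ) ^ (n - (m : ℕ)) * (n.choose (m : ℕ) : ℝ) else 0)) =
        x i ^ (n - (m : ℕ)) * ((-1 : ℝ) ^ (n - (m : ℕ)) * (n.choose (m : ℕ) : ℝ)) := by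
    intro m
    have hm : (m : ℕ) ≤ n := Nat.lt_succ_iff.1 m.isLt
    rw [Finset.sum_eq_single ⟨n - (m : ℕ), by omega⟩]
    · simp only [show (n - (m : ℕ)) + (m : ℕ) = n from Nat.sub_add_cancel hm, if_true]
    · intro l _ hl
      have : (l : ℕ) + (m : ℕ) ≠ n := fun h => hl (Fin.ext (by simp; omega))
      rw [if_neg this, mul_zero]
    · intro h; exact absurd (mem_univ _) h
  simp_rw [hinner]
  rw [sub_eq_add_neg, add_pow, Finset.sum_range, ]
  refine Finset.sum_congr rfl fun m _ => ?_
  rw [neg_pow, show (-1 : ℝ) ^ (n - (m : ℕ)) = (-1) ^ (n - (m : ℕ)) from rfl]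
  ring

variable {n}

/-- `Bᵀ` has trivial kernel when `ρ ≤ n + 1`, the `c_i` are non-zero and the nodes distinct
(a Vandermonde minor). -/
theorem wNodeMat_transpose_mulVec_injective (hρn : ρ ≤ n + 1) {c x : Fin ρ → ℝ}
    (hc : ∀ i, c i ≠ 0) (hx : Function.Injective x) :
    Function.Injective (wNodeMat n c x)ᵀ.mulVecLin := by
  rw [← LinearMap.ker_eq_bot, LinearMap.ker_eq_bot']
  intro w hw
  have hw' : ∀ l : Fin (n + 1), ∑ i, w i * (c i * x i ^ (l : ℕ)) = 0 := by
    intro l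
    have := congrFun hw l
    simpa [Matrix.mulVecLin_apply, Matrix.mulVec_transpose, Matrix.vecMul, dotProduct, wNodeMat]
      using this
  have hvec : Matrix.vecMul (fun i => c i * w i) (Matrix.vandermonde x) = 0 := by
    funext j
    simp only [Matrix.vecMul, dotProduct, Matrix.vandermonde_apply, Pi.zero_apply]
    rw [← hw' ⟨j, by have := j.isLt; omega⟩]
    exact Finset.sum_congr rfl fun i _ => by ring
  have hdet : (Matrix.vandermonde x).det ≠ 0 := Matrix.det_vandermonde_ne_zero_iff.2 hx
  have h0 := Matrix.eq_zero_of_vecMul_eq_zero hdet hvec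
  funext i
  have := congrFun h0 i
  simpa [hc i] using this

/-- `rank B = ρ` and `B` is onto. -/
theorem range_wNodeMat_mulVecLin_eq_top (hρn : ρ ≤ n + 1) {c x : Fin ρ → ℝ}
    (hc : ∀ i, c i ≠ 0) (hx : Function.Injective x) :
    LinearMap.range (wNodeMat n c x).mulVecLin = ⊤ := by
  apply Submodule.eq_top_of_finrank_eq
  rw [← rank_eq_finrank_range, ← Matrix.rank_transpose, rank_eq_finrank_range,
    LinearMap.finrank_range_of_inj (wNodeMat_transpose_mulVec_injective hρn hc hx)]

/-- rank is unchanged under `M ↦ Bᵀ M B` with `Bᵀ` injective and `B` onto. -/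
theorem rank_transpose_mul_mul {k : ℕ} (B : Matrix (Fin ρ) (Fin k) ℝ)
    (hinj : Function.Injective Bᵀ.mulVecLin) (hsurj : LinearMap.range B.mulVecLin = ⊤)
    (M : Matrix (Fin ρ) (Fin ρ) ℝ) : (Bᵀ * M * B).rank = M.rank := by
  rw [rank_eq_finrank_range, rank_eq_finrank_range, Matrix.mulVecLin_mul, Matrix.mulVecLin_mul,
    LinearMap.range_comp_of_range_eq_top _ hsurj, LinearMap.range_comp]
  exact (Submodule.equivMapOfInjective _ hinj _).finrank_eq.symm

/-- **THE DICTIONARY.** For exponential Hankel data `q_k = Σ_{i<ρ} c_i x_i^k` with `c_i ≠ 0`,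
distinct nodes and `ρ ≤ n + 1`: `rank (H_n(q) Ω_n H_n(q)) = rank ((x_i − x_j)^n)_{i,j<ρ}`. -/
theorem rank_hsq_omega_hsq (hρn : ρ ≤ n + 1) {c x : Fin ρ → ℝ} (hc : ∀ i, c i ≠ 0)
    (hx : Function.Injective x) :
    (hsq n (expMoments c x) * omega n * hsq n (expMoments c x)).rank = (gram n x).rank := by
  have h1 := hsq_expMoments_eq n c x
  have h2 := hsq_expMoments_eq' n c x
  have hprod : hsq n (expMoments c x) * omega n * hsq n (expMoments c x) =
      (wNodeMat n c x)ᵀ * (nodeMat n x * omega n * (nodeMat n x)ᵀ) * wNodeMat n c x :=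
    calc hsq n (expMoments c x) * omega n * hsq n (expMoments c x)
        = (wNodeMat n c x)ᵀ * nodeMat n x * omega n * ((nodeMat n x)ᵀ * wNodeMat n c x) := by
          rw [← h1, ← h2]
      _ = (wNodeMat n c x)ᵀ * (nodeMat n x * omega n * (nodeMat n x)ᵀ) * wNodeMat n c x := by
          simp only [Matrix.mul_assoc]
  rw [hprod, rank_transpose_mul_mul _ (wNodeMat_transpose_mulVec_injective hρn hc hx)
    (range_wNodeMat_mulVecLin_eq_top hρn hc hx), nodeMat_omega_nodeMat_transpose, Matrix.rank_transpose]

/-- **One-sided rank law input, `n` odd**: for exponential data with `ρ + 1` distinct increasing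
nodes, `3 ≤ ρ + 1 ≤ n + 1`, `ρ + 1` odd: `rank (H_n Ω_n H_n) = ρ` (`= 2⌊(ρ+1)/2⌋`). -/
theorem rank_hsq_omega_hsq_odd_odd {n ρ : ℕ} (hn : Odd n) (hρodd : Odd (ρ + 1)) (hρ : 3 ≤ ρ + 1)
    (hρn : ρ + 1 ≤ n + 1) {c x : Fin (ρ + 1) → ℝ} (hc : ∀ i, c i ≠ 0) (hx : StrictMono x) :
    (hsq n (expMoments c x) * omega n * hsq n (expMoments c x)).rank = ρ := by
  rw [rank_hsq_omega_hsq hρn hc hx.injective, rank_gram_eq_of_odd hn hρodd hρ hρn hx]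

/-- **One-sided rank law input, parity cells**: `2 ≤ ρ ≤ n + 1`, `ρ ≢ n (mod 2)`:
`rank (H_n Ω_n H_n) = ρ`. -/
theorem rank_hsq_omega_hsq_parity {n ρ : ℕ} (hρ : 2 ≤ ρ) (hρn : ρ ≤ n + 1) (hpar : ρ % 2 ≠ n % 2)
    {c x : Fin ρ → ℝ} (hc : ∀ i, c i ≠ 0) (hx : StrictMono x) :
    (hsq n (expMoments c x) * omega n * hsq n (expMoments c x)).rank = ρ := by
  rw [rank_hsq_omega_hsq hρn hc hx.injective, rank_gram_eq hρ hρn hpar hx]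

end Dictionary


/-! ### `n` even: the small even cells `ρ = 2` and `ρ = 4` -/

section SmallEven

/-- the hollow symmetric `4 × 4` determinant. -/
theorem det_hollow_four (a b c d e f : ℝ) :
    Matrix.det !![0, a, b, c; a, 0, d, e; b, d, 0, f; c, e, f, 0] =
      a ^ 2 * f ^ 2 + b ^ 2 * e ^ 2 + c ^ 2 * d ^ 2 - 2 * a * f * b * e - 2 * a * f * c * d
        - 2 * b * e * c * d := by
  rw [Matrix.det_succ_row_zero]
  simp [Fin.sum_univ_succ, Matrix.det_fin_three, Matrix.submatrix_apply, Fin.succAbove]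
  ring

/-- **Cell (n even ≥ 4, ρ = 4)**: `det ((x_i − x_j)^n)_{i,j<4} > 0` for `x_0 < x_1 < x_2 < x_3`
(Heron form of the hollow `4 × 4` determinant + the line Ptolemy identity
`d_{02} d_{13} = d_{01} d_{23} + d_{03} d_{12}` + strict super-additivity of `m`-th powers, `n = 2m`,
re-derived inline). -/
theorem det_gram_four_pos {n : ℕ} (hn : Even n) (h4 : 4 ≤ n) {x : Fin 4 → ℝ} (hx : StrictMono x) :
    0 < (gram n x).det := by
  obtain ⟨m, rfl⟩ := hn
  have hm : 2 ≤ m := by omega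
  have hm0 : m + m ≠ 0 := by omega
  have hevn : Even (m + m) := ⟨m, rfl⟩
  -- gaps
  have h01 : 0 < x 1 - x 0 := sub_pos.2 (hx (by decide))
  have h12 : 0 < x 2 - x 1 := sub_pos.2 (hx (by decide))
  have h23 : 0 < x 3 - x 2 := sub_pos.2 (hx (by decide))
  have h02 : 0 < x 2 - x 0 := by linarith
  have h13 : 0 < x 3 - x 1 := by linarith
  have h03 : 0 < x 3 - x 0 := by linarith
  -- symmetry of the entries (even exponent)
  have hsym : ∀ u v : ℝ, (v - u) ^ (m + m) = (u - v) ^ (m + m) := by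
    intro u v; rw [← neg_sub u v, hevn.neg_pow]
  have hG : gram (m + m) x = !![0, (x 0 - x 1) ^ (m + m), (x 0 - x 2) ^ (m + m), (x 0 - x 3) ^ (m + m);
      (x 0 - x 1) ^ (m + m), 0, (x 1 - x 2) ^ (m + m), (x 1 - x 3) ^ (m + m);
      (x 0 - x 2) ^ (m + m), (x 1 - x 2) ^ (m + m), 0, (x 2 - x 3) ^ (m + m);
      (x 0 - x 3) ^ (m + m), (x 1 - x 3) ^ (m + m), (x 2 - x 3) ^ (m + m), 0] := by
    ext i j
    fin_cases i <;> fin_cases j <;>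
      simp [gram, zero_pow hm0, hsym (x 0) (x 1), hsym (x 0) (x 2), hsym (x 0) (x 3),
        hsym (x 1) (x 2), hsym (x 1) (x 3), hsym (x 2) (x 3)]
  rw [hG, det_hollow_four]
  -- the entries are squares of m-th powers of the gaps
  set s01 := (x 1 - x 0) ^ m with hs01
  set s02 := (x 2 - x 0) ^ m with hs02
  set s03 := (x 3 - x 0) ^ m with hs03
  set s12 := (x 2 - x 1) ^ m with hs12
  set s13 := (x 3 - x 1) ^ m with hs13
  set s23 := (x 3 - x 2) ^ m with hs23
  have hsqr : ∀ u v : ℝ, (u - v) ^ (m + m) = ((v - u) ^ m) ^ 2 := by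
    intro u v; rw [← hsym, pow_add, sq]
  rw [hsqr (x 0) (x 1), hsqr (x 0) (x 2), hsqr (x 0) (x 3), hsqr (x 1) (x 2), hsqr (x 1) (x 3),
    hsqr (x 2) (x 3)]
  -- Heron form
  set U := s01 * s23 with hU
  set V := s02 * s13 with hV
  set W := s03 * s12 with hW
  have hdet : (s01 ^ 2) ^ 2 * (s23 ^ 2) ^ 2 + (s02 ^ 2) ^ 2 * (s13 ^ 2) ^ 2 +
        (s03 ^ 2) ^ 2 * (s12 ^ 2) ^ 2 - 2 * s01 ^ 2 * s23 ^ 2 * s02 ^ 2 * s13 ^ 2 -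
        2 * s01 ^ 2 * s23 ^ 2 * s03 ^ 2 * s12 ^ 2 - 2 * s02 ^ 2 * s13 ^ 2 * s03 ^ 2 * s12 ^ 2 =
      -((U + V + W) * (V + W - U) * (U - V + W) * (U + V - W)) := by
    rw [hU, hV, hW]; ring
  rw [hdet]
  -- Ptolemy on the line and the power inequality
  set A := (x 1 - x 0) * (x 3 - x 2) with hA
  set B := (x 3 - x 0) * (x 2 - x 1) with hB
  have hApos : 0 < A := mul_pos h01 h23
  have hBpos : 0 < B := mul_pos h03 h12
  have hUA : U = A ^ m := by rw [hU, hs01, hs23, hA, mul_pow]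
  have hWB : W = B ^ m := by rw [hW, hs03, hs12, hB, mul_pow]
  have hVAB : V = (A + B) ^ m := by
    rw [hV, hs02, hs13, ← mul_pow]
    congr 1
    rw [hA, hB]; ring
  -- strict super-additivity of m-th powers (m ≥ 2): A^m + B^m < (A + B)^m
  -- (the tree has this as `Summit.Ventures.PQCStructure.Ladder.NormDownSizeLawEquality.pow_add_pow_lt`;
  --  re-derived inline to keep the HSemireg venture free of a PQC import)
  have hpow : A ^ m + B ^ m < (A + B) ^ m := by
    obtain ⟨k, rfl⟩ : ∃ k, m = k + 1 := ⟨m - 1, by omega⟩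
    have hk : k ≠ 0 := by omega
    have hle := pow_add_pow_le hApos.le hBpos.le hk
    have hpos : 0 < A * B ^ k + B * A ^ k := by positivity
    calc A ^ (k + 1) + B ^ (k + 1) < A ^ (k + 1) + B ^ (k + 1) + (A * B ^ k + B * A ^ k) :=
          lt_add_of_pos_right _ hpos
      _ = (A + B) * (A ^ k + B ^ k) := by ring
      _ ≤ (A + B) * (A + B) ^ k := mul_le_mul_of_nonneg_left hle (by positivity)
      _ = (A + B) ^ (k + 1) := by ring
  have hVgt : U + W < V := by rw [hUA, hWB, hVAB]; exact hpow
  have hUpos : 0 < U := by rw [hUA]; positivity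
  have hWpos : 0 < W := by rw [hWB]; positivity
  have f1 : 0 < U + V + W := by linarith
  have f2 : 0 < V + W - U := by linarith
  have f3 : U - V + W < 0 := by linarith
  have f4 : 0 < U + V - W := by linarith
  have hneg : (U + V + W) * (V + W - U) * (U - V + W) * (U + V - W) < 0 :=
    mul_neg_of_neg_of_pos (mul_neg_of_pos_of_neg (mul_pos f1 f2) f3) f4
  linarith

/-- rank form of the `ρ = 4` cell. -/
theorem rank_gram_four {n : ℕ} (hn : Even n) (h4 : 4 ≤ n) {x : Fin 4 → ℝ} (hx : StrictMono x) :
    (gram n x).rank = 4 := by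
  have hdet : (gram n x).det ≠ 0 := (det_gram_four_pos hn h4 hx).ne'
  have hU : IsUnit (gram n x) := (Matrix.isUnit_iff_isUnit_det _).2 (isUnit_iff_ne_zero.2 hdet)
  rw [Matrix.rank_of_isUnit _ hU, Fintype.card_fin]

/-- **Cell ρ = 2** (any `n ≥ 1`, `x_0 < x_1`): `det = −(x_1 − x_0)^{2n} < 0`, rank `2`. -/
theorem rank_gram_two {n : ℕ} (hn : 1 ≤ n) {x : Fin 2 → ℝ} (hx : StrictMono x) :
    (gram n x).rank = 2 := by
  have h01 : x 0 - x 1 ≠ 0 := sub_ne_zero.2 (hx.injective.ne (by decide))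
  have h10 : x 1 - x 0 ≠ 0 := sub_ne_zero.2 (hx.injective.ne (by decide))
  have hdet : (gram n x).det ≠ 0 := by
    rw [Matrix.det_fin_two]
    simp only [gram, Matrix.of_apply, sub_self, zero_pow (by omega : n ≠ 0), zero_mul, zero_sub,
      neg_ne_zero]
    exact mul_ne_zero (pow_ne_zero _ h01) (pow_ne_zero _ h10)
  have hU : IsUnit (gram n x) := (Matrix.isUnit_iff_isUnit_det _).2 (isUnit_iff_ne_zero.2 hdet)
  rw [Matrix.rank_of_isUnit _ hU, Fintype.card_fin]

end SmallEven

end Summit.Ventures.HSemireg.ApolarGram
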